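import Summits.BirchSwinnertonDyer.BirchSwinnertonDyer.Theses.ByReductionTypeAtTwo
import Summits.BirchSwinnertonDyer.BirchSwinnertonDyer.Theorems.ByReductionTypeAtTwoSupersingularUniformFlatLine
import Summits.BirchSwinnertonDyer.BirchSwinnertonDyer.Theorems.ByReductionTypeAtTwoSupersingularFlatBlindEulerChar
import Summits.BirchSwinnertonDyer.BirchSwinnertonDyer.Theorems.ByReductionTypeAtTwoSupersingularFlatBlindNoCotorsion
import Summits.BirchSwinnertonDyer.BirchSwinnertonDyer.Theorems.ByReductionTypeAtTwoSupersingularFlatBlindControlOfLocal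
import Summits.BirchSwinnertonDyer.BirchSwinnertonDyer.Theorems.ByReductionTypeAtTwoSupersingularTwoAdicImageCriterion
import Summits.BirchSwinnertonDyer.BirchSwinnertonDyer.Theorems.AlignedTransportAtTwoMainConjectureOfRankZeroBSDAtTwoTwoFixedPointLambdaParity
import Summits.BirchSwinnertonDyer.BirchSwinnertonDyer.Theorems.LambdaTransportDoorAtTwoMatsunoClassSecondFixedPoint
import Summits.BirchSwinnertonDyer.Rank1Residual.F1Sign2.HondaSystemAtTwo
import Summits.BirchSwinnertonDyer.Rank1Residual.Supersingular.BlindControlTwo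
import Summits.BirchSwinnertonDyer.Rank1Residual.X1.MuLambdaAlgebra
import Summits.BirchSwinnertonDyer.Rank1Residual.X5.TwoAdicTargets
import Summits.BirchSwinnertonDyer.Rank1Residual.P2.EmptyCellsAtTwo
import Literature.NumberTheory.EllipticCurves.AnticyclotomicSignedSelmerFiniteIndex
import Literature.NumberTheory.EllipticCurves.IwasawaMuLambdaDefinitions
import Literature.NumberTheory.EllipticCurves.QuadraticTwist
import Literature.NumberTheory.EllipticCurves.Selmer
import Literature.NumberTheory.EllipticCurves.Rank1Residual.Predicates
import HarnessLib

/-!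
# Route `ByReductionTypeAtTwo` (rung K4), crux `SupersingularRankZeroAtTwo` (item stmt-BirchSwinnertonDyer-19097): **THE ♭ BLIND PINCH —
# Miller's `BSD(E,2)` in analytic rank `0` from the Kato half, the analytic certificates `μ(L′) = 0`, `λ(L′) ≤ 1`, and the
# algebraic blind zero `(T+2) ∣ ξ`** — the KERNEL §3 of seat `-imc`'s crux workfile `Cruxes/SupersingularRankZeroAtTwo/D87TwistPointPinchAtTwo.lean`
# (v1.2, sha16 `7dfbef126b3b178b`, §3 VERBATIM) RE-LANDED as an importable Theorems module (director-bsd (869)(a)/(874)(b): `Cruxes`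
# modules are not importable in practice; v2.17 of the registered line `odd_blind_package` cites THIS file for the λ♭ = 1 even-row closer)

HONEST FRAMING (cell `bsd-2adic`, run/shared/lean/pub/bsd-2adic/, seat `bsd-2adic-ss-1` GEN 24 = LEAD lineage of 19097; author of the
mathematics: seat `-imc` g34/g35 (D87 v1.0–v1.2), bookkeeping REF1 §484 R484a; HUMAN RULINGS D-0036 / D-0054 / D-0074): THEOREMS ONLY (no
definition, no named fact, no instance, no `sorry`, axioms the standard trio); pure `Λ = ℤ₂⟦T⟧`-algebra plus the tree's rank-`0` signed
readings at the TRIVIAL character; UNCONDITIONAL except for the displayed print binder `hGZK : rank_eq_analyticRank_of_analyticRank_le_one`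
of `bsdp_two_of_flatBlindPinch` (Gross–Zagier–Kolyvagin, as everywhere in the line).  Closes no stub: it is the per-row CLOSER that K87-C
(t42 GEN 46 ★★ p827897 `BlindPinch.blindZeroOfTwistSelmerCorankAtTwo`, unconditional) feeds on the rows {`corank Sel_{2^∞}(E^{(2)}) ≥ 2`,
`μ♭ = 0`, `λ♭ = 1`} of stub 7 `LowerBoundOffGenericOdd`; no consumer in the registered line before REF1 R-87 PASS and the v2.17 word;
nothing booked; BSD is proved for no curve by this file.

WHAT (D87 §3, names kept): `X_add_C_two_ne_zero` (`T + 2 ≠ 0`), `mu_eq_literature_mu` (the two `μ`/`λ` vocabularies agree, `rfl`),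
`one_le_lam_of_X_add_C_two_dvd` (`(T+2) ∣ ξ ≠ 0 ⟹ 1 ≤ λ(ξ)`), ★ `span_eq_span_of_blindPinch` (THE PINCH: `ξ ∣ G ≠ 0`, `μ(G) = 0`,
`λ(G) ≤ 1`, `(T+2) ∣ ξ` ⟹ `(G) = (ξ)`, `G ∣ ξ`, `λ(ξ) = λ(G) = 1`), ★★ `bsdp_two_of_flatBlindPinch` (Miller's `BSD(E,2)` for a signed datum
`D = (ξ, L′, c)` with (K), (P), `2 ∤ c`, Kato's half, `μ(L′) = 0`, `λ(L′) ≤ 1`, `(T+2) ∣ ξ`, given GZK, `E[2]` irreducible, `L(E,1) ≠ 0`),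
`mu_eq_zero_of_not_C_two_dvd` (`2 ∤ G ⟹ μ(G) = 0`, the certificate form).  BOOKKEEPING (REF1 §484 R484a): `hμ`/`hlam` are read on the
datum's `L′ = ϖ·L♭`; `λ(L′) = λ♭` but `μ(L′) = v₂(ϖ) + μ♭`, so tabulated `μ♭ = 0` certificates discharge `hμ` only GIVEN `v₂(ϖ) = 0`.

References: R. Greenberg, V. Vatsal, Invent. Math. 142 (2000), p. 4; L. C. Washington, *Introduction to Cyclotomic Fields*, §7.1;
R. L. Miller, LMS J. Comput. Math. 14 (2011), Def. 1.1; A. Ray, F. Sprung, (2025) §1.2.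
-/

noncomputable section

open scoped Classical MatrixGroups ModularForm NumberField
open NumberField IsDedekindDomain CongruenceSubgroup WeierstrassCurve PowerSeries
open Literature.NumberTheory.EllipticCurves Literature.NumberTheory.EllipticCurves.IwasawaDual
  Literature.NumberTheory.EllipticCurves.Sprung2012 Literature.NumberTheory.EllipticCurves.Sprung2017
  Literature.NumberTheory.EllipticCurves.ModularForms
  Literature.NumberTheory.EllipticCurves.Rank1Residual Literature.NumberTheory.EllipticCurves.Rank1Residual.Typed
  Literature.NumberTheory.EllipticCurves.Kobayashi2003 Literature.NumberTheory.GaloisRepresentations ZpExtension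
  Literature.NumberTheory.EllipticCurves.AcSigned
open Summit.BirchSwinnertonDyer.Rank1Residual Summit.BirchSwinnertonDyer.Rank1Residual.Supersingular
  Summit.BirchSwinnertonDyer.Rank1Residual.X5.O1 Summit.BirchSwinnertonDyer.Rank1Residual.X1.MuLambda
  Summit.BirchSwinnertonDyer.BirchSwinnertonDyer.Theorems
-- `mu` / `lam` / `pfree` / `red` below are the tree's `Rank1Residual.X1.MuLambda` invariants on `Λ = ℤ₂⟦T⟧` (the namespace of
-- `span_eq_span_iff_mu_le_and_lam_le` and of `AlignedTransportAtTwoTwoFixedPoints.lam_X_add_C_two`); the verbatim port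
-- `Literature.NumberTheory.EllipticCurves.MuLambda.{mu,lam}` agrees with them by `rfl` (`mu_eq_literature_mu` below).

set_option linter.dupNamespace false
set_option autoImplicit false


namespace Summit.BirchSwinnertonDyer.BirchSwinnertonDyer.Theorems.FlatBlindPinch

/-- `T + 2 ≠ 0` in `Λ = ℤ₂⟦T⟧` (its `λ` is `1`). [folklore] -/
theorem X_add_C_two_ne_zero : (PowerSeries.X + PowerSeries.C (2 : ℤ_[2]) : IwasawaAlgebra 2) ≠ 0 := by
  intro h
  have h2 : PowerSeries.constantCoeff (PowerSeries.X + PowerSeries.C (2 : ℤ_[2]) : IwasawaAlgebra 2) = 2 := by simp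
  rw [h, map_zero] at h2
  exact absurd h2 (by norm_num)

/-- The two `μ`/`λ` vocabularies of the tree agree definitionally (`Literature…MuLambda` is the verbatim port of
`Rank1Residual.X1.MuLambda`). [folklore] -/
theorem mu_eq_literature_mu (g : IwasawaAlgebra 2) :
    mu g = Literature.NumberTheory.EllipticCurves.MuLambda.mu g ∧
      lam g = Literature.NumberTheory.EllipticCurves.MuLambda.lam g := ⟨rfl, rfl⟩

/-- **The blind zero forces `λ ≥ 1`**: `(T+2) ∣ ξ ≠ 0 ⟹ 1 ≤ λ(ξ)` (`λ(T+2) = 1`, `λ` is additive). [cite: Washington1997, §7.1] -/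
theorem one_le_lam_of_X_add_C_two_dvd {ξ : IwasawaAlgebra 2} (hξ : ξ ≠ 0)
    (hZ : (PowerSeries.X + PowerSeries.C (2 : ℤ_[2]) : IwasawaAlgebra 2) ∣ ξ) : 1 ≤ lam ξ := by
  obtain ⟨q, hq⟩ := hZ
  have hq0 : q ≠ 0 := by rintro rfl; exact hξ (by rw [hq, mul_zero])
  rw [hq]
  exact AlignedTransportAtTwoTwoFixedPoints.lam_X_add_C_two.symm.le.trans (lam_le_lam_mul X_add_C_two_ne_zero hq0)

/-- **THE PINCH (pure `Λ`-algebra).** If `ξ ∣ G` (Kato's half), `G ≠ 0`, `μ(G) = 0`, `λ(G) ≤ 1` (the analytic certificates)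
and `(T+2) ∣ ξ` (the algebraic blind zero), then `(G) = (ξ)` — BOTH divisibilities, i.e. the ♭ main conjecture for this
datum — and `λ(ξ) = λ(G) = 1`.  (`X1.MuLambda.span_eq_span_iff_mu_le_and_lam_le`: given `G = ξ·h`, `(G) = (ξ) ↔ μ(G) ≤ μ(ξ) ∧
λ(G) ≤ λ(ξ)`.) [cite: GreenbergVatsal2000, p. 4 (after Thm. (1.2))] [cite: Washington1997, §7.1] -/
theorem span_eq_span_of_blindPinch {ξ G : IwasawaAlgebra 2} (hup : ξ ∣ G) (hG : G ≠ 0) (hμ : mu G = 0)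
    (hlam : lam G ≤ 1) (hZ : (PowerSeries.X + PowerSeries.C (2 : ℤ_[2]) : IwasawaAlgebra 2) ∣ ξ) :
    Ideal.span ({G} : Set (IwasawaAlgebra 2)) = Ideal.span {ξ} ∧ G ∣ ξ ∧ lam ξ = 1 ∧ lam G = 1 := by
  obtain ⟨h, hh⟩ := hup
  have hξ : ξ ≠ 0 := by rintro rfl; exact hG (by rw [hh, zero_mul])
  have h1 : 1 ≤ lam ξ := one_le_lam_of_X_add_C_two_dvd hξ hZ
  have hspan : Ideal.span ({G} : Set (IwasawaAlgebra 2)) = Ideal.span {ξ} :=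
    (span_eq_span_iff_mu_le_and_lam_le hξ hG hh).mpr ⟨hμ.le.trans (Nat.zero_le _), hlam.trans h1⟩
  have hdvd : G ∣ ξ := by
    have hmem : ξ ∈ Ideal.span ({G} : Set (IwasawaAlgebra 2)) := by
      rw [hspan]; exact Ideal.mem_span_singleton_self ξ
    exact Ideal.mem_span_singleton.mp hmem
  have hh0 : h ≠ 0 := by rintro rfl; exact hG (by rw [hh, mul_zero])
  have hle : lam ξ ≤ lam G := by rw [hh]; exact lam_le_lam_mul hξ hh0
  exact ⟨hspan, hdvd, by omega, by omega⟩

/-- **KERNEL K87-P `bsdp_two_of_flatBlindPinch` — Miller's `BSD(E,2)` in analytic rank `0` from the Kato half, the two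
analytic certificates `μ(L′) = 0`, `λ(L′) ≤ 1`, and the algebraic blind zero `(T+2) ∣ ξ` — NOTHING at `ψ₂` beyond that.**
For a signed datum `D = (ξ, L′, c)` at `(E,2)` with the tree's rank-`0` readings at the TRIVIAL character ((K)
`EulerCharacteristic`, (P) `Interpolation`, `2 ∤ c`), `E[2]` irreducible, `L(E,1) ≠ 0`, GZK: `(L′) = (ξ)` by
`span_eq_span_of_blindPinch`, then `SignedRankZero.missingLowerBoundAt_of_signedLowerDivisibility` /
`missingUpperBoundAt_of_signedUpperDivisibility` / `Typed.missingPPartAt_of_lower_of_upper` / `Typed.bsdp_of_missingPPartAt`.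
In the registered line this is the closer for stub 7 on {`corank Sel_{2^∞}(E^{(2)}) ≥ 2`, `λ♭ = 1`} (with `(T+2) ∣ ξ` from K87-C)
and on {`a₂ = 0`, even, `λ♭ = 1`} (from K87-E), wired exactly where `bsdp_two_of_genericOdd` wires
`bsdp_two_of_oneDivisibility_of_oddBlindControl` (same `(ξ, L′ = ±ξh, cc)` datum, same `hK`, `hP0`, `hcodd`, `hdvd`).  Sorry-free.
BOOKKEEPING (REF1 §484 R484a, adopted v1.2): `hμ`/`hlam` are read on the datum's `L′ = ϖ·L♭`; `λ(L′) = λ♭` but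
`μ(L′) = v₂(ϖ) + μ♭`, so the tabulated `μ♭ = 0` certificates (SF2-ALL, 47/47 on R-imc-76) discharge `hμ` only GIVEN `v₂(ϖ) = 0`
— the reach figures 41/47 · 43/66 carry that label until the period-unit column (data ask D-imc-87) lands; the line's existing
VALUE closers read their unit-value certificates on the same `L′` and stand on the same footing.
[cite: GreenbergVatsal2000, p. 4] [cite: Miller2011LMS, Def. 1.1] [cite: RaySprung2025, §1.2 (p. 2343)] -/
theorem bsdp_two_of_flatBlindPinch (W : WeierstrassCurve ℚ) [W.IsElliptic] [W.IsGloballyMinimal]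
    (hGZK : rank_eq_analyticRank_of_analyticRank_le_one) (hirr : W.HasIrreducibleModPGaloisRep 2)
    (hL : W.entireLFunction 1 ≠ 0) (D : SignedDatum W 2) (hc : ¬ 2 ∣ D.c) (hK : D.EulerCharacteristic)
    (hP : D.Interpolation) (hup : D.UpperDivisibility) (hμ : mu D.L = 0) (hlam : lam D.L ≤ 1)
    (hZ : (PowerSeries.X + PowerSeries.C (2 : ℤ_[2]) : IwasawaAlgebra 2) ∣ D.xi) : BSDp W 2 := by
  -- `L′ ≠ 0`: otherwise (P) gives `c·t = 0`, `t = 0`, `L(E,1) = 0`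
  have hL0 : D.L ≠ 0 := by
    intro h0
    obtain ⟨t, ht, hLt⟩ := hP
    rw [h0, map_zero] at hLt
    have hcne : D.c ≠ 0 := fun hc0 => hc (by rw [hc0]; exact dvd_zero 2)
    have hc0 : (D.c : ℚ_[2]) ≠ 0 := by exact_mod_cast hcne
    have htz : ((t : ℚ) : ℚ_[2]) = 0 := by
      have h' : (D.c : ℚ_[2]) * ((t : ℚ) : ℚ_[2]) = 0 := by rw [← hLt]; push_cast; rfl
      exact (mul_eq_zero.mp h').resolve_left hc0
    have ht0 : t = 0 := by exact_mod_cast htz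
    have hΩC : (W.realPeriodRat : ℂ) ≠ 0 := Complex.ofReal_ne_zero.mpr W.realPeriodRat_pos_holds.ne'
    apply hL
    have h1 := ht
    rw [ht0, div_eq_iff hΩC] at h1
    simpa using h1
  obtain ⟨hspan, hlowdvd, -, -⟩ := span_eq_span_of_blindPinch hup hL0 hμ hlam hZ
  have hlow : MissingLowerBoundAt W 2 :=
    missingLowerBoundAt_of_signedLowerDivisibility W 2 hGZK hirr hL D hc hK hP hlowdvd
  have hupp : MissingUpperBoundAt W 2 :=
    missingUpperBoundAt_of_signedUpperDivisibility W 2 hGZK hirr hL D hc hK hP hup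
  have hr : W.analyticRank = 0 := analyticRank_eq_zero_of_entireLFunction_one_ne_zero W hL
  exact bsdp_of_missingPPartAt W 2 hGZK (by omega) (missingPPartAt_of_lower_of_upper W 2 hlow hupp)

/-- **Certificate form of the analytic input** — `μ(G) = 0` from `2 ∤ G` in `Λ` (the table's `μ♭ = 0` certificate and the
line's `FineMuZeroOnHabitatAtTwo` both read `¬ C 2 ∣ ·`). [cite: GreenbergVatsal2000, p. 2, (2)] -/
theorem mu_eq_zero_of_not_C_two_dvd {G : IwasawaAlgebra 2}
    (h2 : ¬ (PowerSeries.C (2 : ℤ_[2]) : IwasawaAlgebra 2) ∣ G) : mu G = 0 := by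
  have hred : red G ≠ 0 := by
    rw [Ne, red_eq_zero_iff]; exact_mod_cast h2
  exact (mu_eq_and_pfree_eq (a := 0) hred (by simp)).1

end Summit.BirchSwinnertonDyer.BirchSwinnertonDyer.Theorems.FlatBlindPinch

end
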